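import Summits.CriticalPhenomena.PercolationContinuityZ3.Theorems.Transplant.SkelPhiForcedColumnPlace
import Summits.CriticalPhenomena.PercolationContinuityZ3.Theorems.Transplant.SkelPhiForcedColumnQ
import HarnessLib

/-!
# Quasi-step rung (N3-b), BINDER WAVE, row Q07 «SkelPhiForcedColumnPlace» of WAVE-Q-BINDER-rows v0.6 under (ι) := `Skelφ.QStepsN G φ M`: **PLACEMENT OF THE
# QUASI-COLUMN END** — the two spec facts of `ctColEndQ` (form value `≥ θ D + A`; graph distance `≤ P.N·kitK` from the stem end) and their consequences
# (depth `≥ D`, the ball of radius `ρ` about the end inside the window level, reach from the inner neighbour, frame image in the enlarged level box) — the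
# twins of «SkelPhiForcedColumnPlace» (which assumed `Steps G φ`), radius tokens `KCmax ↦ P.N·KCmax`

builds on p205010 (kernel theorem, internal audit signed; external expert review pending) — nothing in this file uses p205010; nothing here is a claim about any open node
((N3-b), the end state); no carrier, no node, no definition.  Lane `prim-bschramm`, seat `prim-hp-8` (gen 62; binder-wave pen, family Forced*/Root*/RunKits/ApronKitDefs —
captain gen-1 g4, lane INBOX 2026-08-27 07:25Z).  thm row; its floors (`hr₀`, `hT`, `hDw`, `hE`) carry the column radius `×P.N` (refuter p5-g28 reads).  Helper file
(`--supports stmt-CriticalPhenomena-4575 --as helper`).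
WHY (hunk classes (i) binder `(hstep : Steps G φ) ↦ (hqφ : QStepsN G φ P.N)` — common cost bound, located item L-hp8-1 (b); (ii) call sites `ctColEnd/φ_ctColEnd/le_lin_ctCtr/
walk_mem_graphBall ↦ ctColEndQ/φ_ctColEnd_q/le_lin_ctCtr_q/walkQ_mem_graphBall` («SkelPhiForcedColumnQ» Q06, «SkelPhiApronKitDefsQ» Q02, «SkelPhiQStepsN»); (iv) radius: the
quasi-column end is within `P.N·kitK ≤ P.N·KCmax` of the stem end, so every `KCmax` that measures that distance reads `P.N·KCmax` — in `hr₀`, `hT`, `hDw`, the reach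
radius and `hE`; `hKC` (a bound on `kitK`, a planar quantity) is unchanged).  Proofs otherwise byte-identical.  Regression: `qStepsN_of_steps` (`P.N = 1`).
* `ctColEnd_mem_graphBall_kitK_q`, `le_lin_ctColEnd_q`, `shellD_le_sdepth_ctColEnd_q'`, **`ball_ctColEnd_facts_q`**, **`ball_ctColEnd_subset_winLevel_q`**, `ctColEnd_reach_q`,
  `ψ_ctColEnd_mem_Icc_q`.
[cite: KozmaNitzan2024, §4 Lemma 10, p. 19 (Step III: seeds), p. 26 ((29): columns)] [cite: GrimmettPercolation1999, §7.2]
-/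

noncomputable section

open scoped Classical

namespace Summit.CriticalPhenomena.PercolationContinuityZ3.Theorems.Transplant

namespace Skelφ

open MeasureTheory
open Literature.Probability.Percolation Literature.Probability.LatticeModels SimpleGraph KNLevels
open Literature.Probability.Percolation.KozmaNitzan.Cells (oth oth_ne eq_oth_of_ne oth_oth)
open Literature.Barriers.CriticalPhenomena (graphBall graphBall_finite mem_graphBall_self graphBall_mono)
open Skel (winGraph winGraph_adj winGraph_le KitGeom)
open SkelI (tanOff tanTgt tanTgt_mem)

variable {V : Type} [DecidableEq V] {G : SimpleGraph V} [G.LocallyFinite] {ψ φ : V → Site 2}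

/-! ## §1 Placement of the quasi-column end (the two spec facts and their consequences) -/

section PlaceE

variable {w₀ : V} {R : ℕ} {Lo Hi : Site 2} (SF : ∀ (i : Fin 2) (σ : ℤˣ), SideForm ψ φ Lo Hi i σ) {P : ApronPrm} {KCmax ρ : ℕ}

omit [DecidableEq V] [G.LocallyFinite] in
/-- **Spec fact 2**: the quasi-column end is within graph distance `P.N·kitK` of the stem end (under `QStepsN` of the base chart; twin of
`ctColEnd_mem_graphBall_kitK`). [folklore] -/
theorem ctColEnd_mem_graphBall_kitK_q (hqφ : QStepsN G φ P.N) (x : V) :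
    ctColEndQ G SF P w₀ R x ∈ graphBall G (ctT1 G ψ P w₀ R Lo Hi x)
      (P.N * (SF (ctDir G ψ w₀ R Lo Hi x).1 (ctDir G ψ w₀ R Lo Hi x).2).kitK (φ (ctT1 G ψ P w₀ R Lo Hi x)) (shellD P) P.A) := by
  unfold ctColEndQ; exact walkQ_mem_graphBall hqφ _ _ _ _

omit [DecidableEq V] [G.LocallyFinite] in
/-- **Spec fact 1** (form value): the exit side form at the quasi-column end is at least `θ D + A` (twin of `le_lin_ctColEnd`). [folklore] -/
theorem le_lin_ctColEnd_q (hqφ : QStepsN G φ P.N) {x : V}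
    (ht : (SF (ctDir G ψ w₀ R Lo Hi x).1 (ctDir G ψ w₀ R Lo Hi x).2).lin (φ (ctT1 G ψ P w₀ R Lo Hi x)) ≤
      (SF (ctDir G ψ w₀ R Lo Hi x).1 (ctDir G ψ w₀ R Lo Hi x).2).θ (shellD P) + P.A) :
    (SF (ctDir G ψ w₀ R Lo Hi x).1 (ctDir G ψ w₀ R Lo Hi x).2).θ (shellD P) + P.A ≤
      (SF (ctDir G ψ w₀ R Lo Hi x).1 (ctDir G ψ w₀ R Lo Hi x).2).lin (φ (ctColEndQ G SF P w₀ R x)) := by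
  rw [φ_ctColEnd_q hqφ x]; exact le_lin_ctCtr_q SF hqφ ht

/-- The quasi-column end of a contact sits at depth `≥ D` (`θ (2+d) ≤ θ D + A`, `A ≥ 0`; twin of `shellD_le_sdepth_ctColEnd'`). [folklore] -/
theorem shellD_le_sdepth_ctColEnd_q' (hlip : Lip G ψ) (hq : QStepsN G ψ P.N) (hqφ : QStepsN G φ P.N) (hw2 : ∀ i, Lo i + 2 ≤ Hi i) (hA : 0 ≤ P.A)
    (hθA : ∀ (i : Fin 2) (σ : ℤˣ), (SF i σ).θ (2 + P.d) ≤ (SF i σ).θ (shellD P) + P.A)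
    {x : V} (hx : x ∈ outerBoundary (winGraph G w₀ R) (Win G ψ w₀ (Finset.Icc Lo Hi) R)) :
    (shellD P : ℤ) ≤ sdepth ψ Lo Hi (ctDir G ψ w₀ R Lo Hi x).1 (ctDir G ψ w₀ R Lo Hi x).2 (ctColEndQ G SF P w₀ R x) := by
  have ht := ψ_ctT1 hlip hq hw2 hx
  have hzlt := (SF (ctDir G ψ w₀ R Lo Hi x).1 (ctDir G ψ w₀ R Lo Hi x).2).lin_lt_of_sdepth_lt (φ := φ) (v := ctT1 G ψ P w₀ R Lo Hi x)
    (m := 2 + P.d) (by rw [ht.1]; omega)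
  exact (SF _ _).le_sdepth_of_lin (by
    have h1 := le_lin_ctColEnd_q SF hqφ (x := x) (by have := hθA (ctDir G ψ w₀ R Lo Hi x).1 (ctDir G ψ w₀ R Lo Hi x).2; linarith)
    linarith)

/-- **The ball of radius `ρ` about the QUASI-COLUMN END of a near contact** (twin of `ball_ctColEnd_facts`, radius `KCmax ↦ P.N·KCmax` in `hr₀`/`hT`/`hDw`):
(a) inside `B_G(w₀, R)`, (b) tangentially at least `D` inside, (c) at depth between `D − ρ` and `(Hi − Lo) − D` behind the exit side. [this work] -/
theorem ball_ctColEnd_facts_q (hlip : Lip G ψ) (hq : QStepsN G ψ P.N) (hqφ : QStepsN G φ P.N) (hwide : ∀ i, Lo i + 2 * tanOff P.ℓs P.M ≤ Hi i)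
    (hKC : ∀ (i : Fin 2) (σ : ℤˣ) (z : Site 2), (SF i σ).θ (1 + P.d) ≤ (SF i σ).lin z → (SF i σ).lin z < (SF i σ).θ (2 + P.d) →
      (SF i σ).kitK z (shellD P) P.A ≤ KCmax)
    (hA : 0 ≤ P.A) (hθA : ∀ (i : Fin 2) (σ : ℤˣ), (SF i σ).θ (2 + P.d) ≤ (SF i σ).θ (shellD P) + P.A)
    (hr₀ : P.N * (tanOff P.ℓs P.M + 1) + P.N * P.d + (P.N * KCmax + ρ) ≤ P.r₀) (hR : P.r₀ ≤ R)
    (hT : (shellD P : ℤ) + P.N * KCmax + ρ ≤ tanOff P.ℓs P.M) (hDw : ∀ i, Lo i + ((shellD P + 1 + P.d + P.N * KCmax + ρ : ℕ) : ℤ) ≤ Hi i)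
    {x : V} (hx : x ∈ outerBoundary (winGraph G w₀ R) (Win G ψ w₀ (Finset.Icc Lo Hi) R)) (hnear : IsNear G ψ Lo Hi P w₀ R x)
    {v : V} (hv : v ∈ graphBall G (ctColEndQ G SF P w₀ R x) ρ) :
    v ∈ graphBall G w₀ R ∧
      (Lo (oth (ctDir G ψ w₀ R Lo Hi x).1) + shellD P ≤ ψ v (oth (ctDir G ψ w₀ R Lo Hi x).1) ∧
        ψ v (oth (ctDir G ψ w₀ R Lo Hi x).1) ≤ Hi (oth (ctDir G ψ w₀ R Lo Hi x).1) - shellD P) ∧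
      (shellD P : ℤ) - ρ ≤ sdepth ψ Lo Hi (ctDir G ψ w₀ R Lo Hi x).1 (ctDir G ψ w₀ R Lo Hi x).2 v ∧
      sdepth ψ Lo Hi (ctDir G ψ w₀ R Lo Hi x).1 (ctDir G ψ w₀ R Lo Hi x).2 v ≤
        Hi (ctDir G ψ w₀ R Lo Hi x).1 - Lo (ctDir G ψ w₀ R Lo Hi x).1 - shellD P := by
  have hw2 : ∀ i, Lo i + 2 ≤ Hi i := fun i => by have := hwide i; unfold tanOff at this; omega
  have ht := ψ_ctT1 hlip hq hw2 hx
  have hzge := (SF (ctDir G ψ w₀ R Lo Hi x).1 (ctDir G ψ w₀ R Lo Hi x).2).le_lin_of_le_sdepth (φ := φ) (v := ctT1 G ψ P w₀ R Lo Hi x)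
    (m := 1 + P.d) (by rw [ht.1])
  have hzlt := (SF (ctDir G ψ w₀ R Lo Hi x).1 (ctDir G ψ w₀ R Lo Hi x).2).lin_lt_of_sdepth_lt (φ := φ) (v := ctT1 G ψ P w₀ R Lo Hi x)
    (m := 2 + P.d) (by rw [ht.1]; omega)
  -- distances
  have hct : ctColEndQ G SF P w₀ R x ∈ graphBall G (ctT1 G ψ P w₀ R Lo Hi x) (P.N * KCmax) :=
    graphBall_mono G _ (Nat.mul_le_mul_left P.N (hKC _ _ _ hzge hzlt)) (ctColEnd_mem_graphBall_kitK_q SF (P := P) (w₀ := w₀) (R := R) hqφ x)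
  have hvt : v ∈ graphBall G (ctT1 G ψ P w₀ R Lo Hi x) (P.N * KCmax + ρ) := BoxProdZ2.mem_graphBall_add G hct hv
  have hvy : v ∈ graphBall G (ctY G ψ w₀ R Lo Hi x) (P.N * (tanOff P.ℓs P.M + 1) + P.N * P.d + (P.N * KCmax + ρ)) :=
    BoxProdZ2.mem_graphBall_add G (ctT1_mem_graphBall hq hwide hx) hvt
  refine ⟨?_, ?_, ?_, ?_⟩
  · have h := BoxProdZ2.mem_graphBall_add G hnear (graphBall_mono G _ hr₀ hvy)
    rwa [Nat.sub_add_cancel hR] at h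
  · have h := abs_sub_le_of_mem_graphBall hlip hvt (oth (ctDir G ψ w₀ R Lo Hi x).1)
    rw [ht.2, abs_le] at h
    have hτ := tanTgt_mem (oth (ctDir G ψ w₀ R Lo Hi x).1) (hwide (oth _)) (ψ (ctY G ψ w₀ R Lo Hi x))
    push_cast at h
    constructor <;> linarith [h.1, h.2, hτ.1, hτ.2]
  · have hc := shellD_le_sdepth_ctColEnd_q' SF hlip hq hqφ hw2 hA hθA hx
    have h := sdepth_sub_le_of_mem_graphBall hlip (Lo := Lo) (Hi := Hi) (ctDir G ψ w₀ R Lo Hi x).1 (ctDir G ψ w₀ R Lo Hi x).2 hv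
    rw [abs_le] at h; linarith [h.1]
  · have h := sdepth_sub_le_of_mem_graphBall hlip (Lo := Lo) (Hi := Hi) (ctDir G ψ w₀ R Lo Hi x).1 (ctDir G ψ w₀ R Lo Hi x).2 hvt
    rw [ht.1, abs_le] at h
    have hwid := hDw (ctDir G ψ w₀ R Lo Hi x).1
    push_cast at h hwid ⊢
    linarith [h.2]

end PlaceE

/-- **The ball of radius `ρ` about the quasi-column end of a near contact lies in the window level** (twin of `ball_ctColEnd_subset_winLevel`; `D ≥ ρ + 1`; placement
radii `×P.N`). [folklore] -/
theorem ball_ctColEnd_subset_winLevel_q {lo hi : Site 2} {j : ℕ} {w₀ : V} {R : ℕ}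
    (SF : ∀ (i : Fin 2) (σ : ℤˣ), SideForm ψ φ (lo - (j : Site 2)) (hi + (j : Site 2)) i σ) {P : ApronPrm} {KCmax ρ : ℕ}
    (hlip : Lip G ψ) (hq : QStepsN G ψ P.N) (hqφ : QStepsN G φ P.N) (hwide : ∀ i, (lo - (j : Site 2)) i + 2 * tanOff P.ℓs P.M ≤ (hi + (j : Site 2)) i)
    (hKC : ∀ (i : Fin 2) (σ : ℤˣ) (z : Site 2), (SF i σ).θ (1 + P.d) ≤ (SF i σ).lin z → (SF i σ).lin z < (SF i σ).θ (2 + P.d) →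
      (SF i σ).kitK z (shellD P) P.A ≤ KCmax)
    (hA : 0 ≤ P.A) (hθA : ∀ (i : Fin 2) (σ : ℤˣ), (SF i σ).θ (2 + P.d) ≤ (SF i σ).θ (shellD P) + P.A)
    (hr₀ : P.N * (tanOff P.ℓs P.M + 1) + P.N * P.d + (P.N * KCmax + ρ) ≤ P.r₀) (hR : P.r₀ ≤ R)
    (hT : (shellD P : ℤ) + P.N * KCmax + ρ ≤ tanOff P.ℓs P.M)
    (hDw : ∀ i, (lo - (j : Site 2)) i + ((shellD P + 1 + P.d + P.N * KCmax + ρ : ℕ) : ℤ) ≤ (hi + (j : Site 2)) i) (hDρ : ρ + 1 ≤ shellD P)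
    {x : V} (hx : x ∈ outerBoundary (winGraph G w₀ R) (winLevel G ψ w₀ R lo hi j))
    (hnear : IsNear G ψ (lo - (j : Site 2)) (hi + (j : Site 2)) P w₀ R x) :
    ∀ v ∈ graphBall G (ctColEndQ G SF P w₀ R x) ρ, v ∈ winLevel G ψ w₀ R lo hi j := by
  intro v hv
  obtain ⟨hball, htan, hlow, htop⟩ := ball_ctColEnd_facts_q SF hlip hq hqφ hwide hKC hA hθA hr₀ hR hT hDw hx hnear hv
  unfold winLevel
  rw [mem_Win, Finset.mem_Icc]
  refine ⟨hball, ?_, ?_⟩ <;> intro i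
  · by_cases hi : i = (ctDir G ψ w₀ R (lo - (j : Site 2)) (hi + (j : Site 2)) x).1
    · rw [hi]; unfold sdepth at hlow htop; split_ifs at hlow htop <;> push_cast at hlow htop hDρ ⊢ <;> omega
    · rw [eq_oth_of_ne hi]; have := htan.1; push_cast at this ⊢; omega
  · by_cases hi : i = (ctDir G ψ w₀ R (lo - (j : Site 2)) (hi + (j : Site 2)) x).1
    · rw [hi]; unfold sdepth at hlow htop; split_ifs at hlow htop <;> push_cast at hlow htop hDρ ⊢ <;> omega
    · rw [eq_oth_of_ne hi]; have := htan.2; push_cast at this ⊢; omega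

/-- **The quasi-column end is within `N(T₀+1) + N·d + N·KCmax` of the inner neighbour** (twin of `ctColEnd_reach`). [folklore] -/
theorem ctColEnd_reach_q {w₀ : V} {R : ℕ} {Lo Hi : Site 2} (SF : ∀ (i : Fin 2) (σ : ℤˣ), SideForm ψ φ Lo Hi i σ) {P : ApronPrm} {KCmax : ℕ}
    (hlip : Lip G ψ) (hq : QStepsN G ψ P.N) (hqφ : QStepsN G φ P.N) (hwide : ∀ i, Lo i + 2 * tanOff P.ℓs P.M ≤ Hi i)
    (hKC : ∀ (i : Fin 2) (σ : ℤˣ) (z : Site 2), (SF i σ).θ (1 + P.d) ≤ (SF i σ).lin z → (SF i σ).lin z < (SF i σ).θ (2 + P.d) →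
      (SF i σ).kitK z (shellD P) P.A ≤ KCmax)
    {x : V} (hx : x ∈ outerBoundary (winGraph G w₀ R) (Win G ψ w₀ (Finset.Icc Lo Hi) R)) :
    ctColEndQ G SF P w₀ R x ∈ graphBall G (ctY G ψ w₀ R Lo Hi x) (P.N * (tanOff P.ℓs P.M + 1) + P.N * P.d + P.N * KCmax) := by
  have hw2 : ∀ i, Lo i + 2 ≤ Hi i := fun i => by have := hwide i; unfold tanOff at this; omega
  have ht := ψ_ctT1 hlip hq hw2 hx
  have hzge := (SF (ctDir G ψ w₀ R Lo Hi x).1 (ctDir G ψ w₀ R Lo Hi x).2).le_lin_of_le_sdepth (φ := φ) (v := ctT1 G ψ P w₀ R Lo Hi x)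
    (m := 1 + P.d) (by rw [ht.1])
  have hzlt := (SF (ctDir G ψ w₀ R Lo Hi x).1 (ctDir G ψ w₀ R Lo Hi x).2).lin_lt_of_sdepth_lt (φ := φ) (v := ctT1 G ψ P w₀ R Lo Hi x)
    (m := 2 + P.d) (by rw [ht.1]; omega)
  have hct : ctColEndQ G SF P w₀ R x ∈ graphBall G (ctT1 G ψ P w₀ R Lo Hi x) (P.N * KCmax) :=
    graphBall_mono G _ (Nat.mul_le_mul_left P.N (hKC _ _ _ hzge hzlt)) (ctColEnd_mem_graphBall_kitK_q SF (P := P) (w₀ := w₀) (R := R) hqφ x)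
  exact BoxProdZ2.mem_graphBall_add G (ctT1_mem_graphBall hq hwide hx) hct

/-- **The frame image of the quasi-column end lies in the `j + reach`-enlargement of the level box** (twin of `ψ_ctColEnd_mem_Icc`). [folklore] -/
theorem ψ_ctColEnd_mem_Icc_q {w₀ : V} {R : ℕ} {lo hi : Site 2} {j : ℕ}
    (SF : ∀ (i : Fin 2) (σ : ℤˣ), SideForm ψ φ (lo - (j : Site 2)) (hi + (j : Site 2)) i σ) {P : ApronPrm} {KCmax E : ℕ}
    (hlip : Lip G ψ) (hq : QStepsN G ψ P.N) (hqφ : QStepsN G φ P.N) (hwide : ∀ i, (lo - (j : Site 2)) i + 2 * tanOff P.ℓs P.M ≤ (hi + (j : Site 2)) i)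
    (hKC : ∀ (i : Fin 2) (σ : ℤˣ) (z : Site 2), (SF i σ).θ (1 + P.d) ≤ (SF i σ).lin z → (SF i σ).lin z < (SF i σ).θ (2 + P.d) →
      (SF i σ).kitK z (shellD P) P.A ≤ KCmax)
    (hE : j + (P.N * (tanOff P.ℓs P.M + 1) + P.N * P.d + P.N * KCmax) ≤ E)
    {x : V} (hx : x ∈ outerBoundary (winGraph G w₀ R) (winLevel G ψ w₀ R lo hi j)) :
    ψ (ctColEndQ G SF P w₀ R x) ∈ Finset.Icc (lo - ((E : ℕ) : Site 2)) (hi + ((E : ℕ) : Site 2)) := by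
  have hy := ctY_mem_Icc (G := G) (ψ := ψ) (w₀ := w₀) (R := R) hx
  have hd := ctColEnd_reach_q SF hlip hq hqφ hwide hKC hx
  rw [Finset.mem_Icc] at hy ⊢
  constructor <;> intro i
  · have h1 := abs_sub_le_of_mem_graphBall hlip hd i
    have h2 := hy.1 i
    rw [abs_le] at h1
    simp only [Pi.sub_apply, Pi.natCast_apply] at h2 ⊢
    push_cast at h1 h2 ⊢
    have : (j : ℤ) + (P.N * (tanOff P.ℓs P.M + 1) + P.N * P.d + P.N * KCmax : ℕ) ≤ E := by exact_mod_cast hE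
    push_cast at this
    linarith [h1.1]
  · have h1 := abs_sub_le_of_mem_graphBall hlip hd i
    have h2 := hy.2 i
    rw [abs_le] at h1
    simp only [Pi.add_apply, Pi.natCast_apply] at h2 ⊢
    push_cast at h1 h2 ⊢
    have : (j : ℤ) + (P.N * (tanOff P.ℓs P.M + 1) + P.N * P.d + P.N * KCmax : ℕ) ≤ E := by exact_mod_cast hE
    push_cast at this
    linarith [h1.2]

end Skelφ

end Summit.CriticalPhenomena.PercolationContinuityZ3.Theorems.Transplant

end
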